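import Summits.QuantumFields.BalabanUV.T4Continuum.Support.NE7K1LinTorusEntries

/-!
# NE7K1LinTorusFluctDecay — row NE7 (node U5), candidate route HOM, path H1L, cell K1-lin(s): I3 ON THE TORUS, FIRST HALF —
# Combes–Thomas for the fluctuation block of run B's TORUS chart operator `H_B^𝕋` with the CENTRED sup-norm weight
# (NEEDS-ESTIMATE #E1, the input of B-E1's strip clauses (b′)(e′))

Lineage `b2b-balaban-t4-ne7-p2` (CRUX PROVER NE7 #2), generation 73; file 43 — the torus twin of file 28 §1 (`NE7K1LinSchurKernelDecay`:
Combes–Thomas on the fluctuation block of run B's chart operator, A = 0, one scale); file 44 (`NE7K1LinTorusKernelDecay`) draws the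
entry decay of the line.  File 42 supplied the entries of `H_B^𝕋` and the
geometry: with the CENTRE `c₀ = (K_μ)` of the representatives `boxDom (dbl K)` as base point the plain sup-norm `ρ(x) = |x − c₀|_∞` is
the torus distance to `c₀` and is 1-Lipschitz along torus bonds; translation invariance of the line (file 36) then moves the base
point anywhere.

* §1 THE FLUCTUATION BLOCK `D = (H_B^𝕋)₂₂`: floor `2n²∕L^{d+1}` (`torFluct_coercive`, domination + run B's block Poincaré), sparse
  entries (`torFluct_entry`), the conjugation error of the weight `θ·ρ(site ·)` (`torFluct_conjError_le`:
  `≤ (e^θ − 1)·16(d+1)²n²L²·‖w‖²`) and **`torFluct_inv_entry_decay`**: `|D⁻¹(p,q)| ≤ (L^{d+1}∕n²)·e^{−θ(ρ(site p) − ρ(site q))}`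
  whenever `16(d+1)²L^{d+3}(e^θ − 1) ≤ 1` — `Beta.CombesThomasForm.combesThomas_form` BY NAME; the rate condition is file 28's,
  FREE of the mesh and of the torus size.
(File 44: the Schur correction decays, the local parts have torus range one, the line's entries decay in the torus distance.)

HONEST FRAMING: [folklore]; ONE scale, `a = 0`, U = 1, crude explicit constants; a helper toward the input of B-E1's strip clauses;
nothing of Bałaban's asserted; no `sorry`.  Census only; NE7 NOT PRINTED ∕ NOT
PROVED; spine 0∕9; FIXED FINITE T⁴, rung (B)+1; NOT infinite volume, NOT mass gap, NOT Clay.  HONEST DEPENDENCY: continuum YM on T⁴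
⇐ BetaPertH ∧ nine spine estimates (0/9 proved); BetaPertH ⇐ (D1) ∧ (D4) ∧ CAP+tail; G-an2-4 gates asym, D1 and NE2/3/4.
-/

noncomputable section

open Finset Matrix

namespace Summit.QuantumFields.BalabanUV.T4Continuum.NE7K1LinTorusFluctDecay

open Literature.MathematicalPhysics.QuantumFieldTheory.Balaban1983to89
open Literature.MathematicalPhysics.QuantumFieldTheory.Balaban1983to89.B4ContourShift (supNorm supNorm_nonneg abs_le_supNorm
  exists_supNorm_eq)
open Literature.MathematicalPhysics.QuantumFieldTheory.Balaban1983to89.B4Reflection242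
open Literature.MathematicalPhysics.QuantumFieldTheory.Balaban1983to89.B4Lower18
open Literature.MathematicalPhysics.QuantumFieldTheory.Balaban1983to89.B4TorusPositivity (wrap wrap_wrap_add)
open Literature.MathematicalPhysics.QuantumFieldTheory.Balaban1983to89.Beta.CombesThomasForm (combesThomas_form abs_exp_sub_one_le)
open NE7K1LinFoldKernels NE7K1LinFoldMatrices NE7K1LinSchurFold NE7K1LinTorusChart NE7K1LinSchurFoldBox
  NE7K1LinTorusLineInvariant NE7K1LinTorusLineSymbol NE7K1LinTorusSymbolReal NE7K1LinTorusJensen NE7K1LinTorusFloor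
  NE7K1LinTorusEntries NE7K1LinBlockCoords NE7K1LinSchurLineU1 NE7K1LinSchurLineForm NE7K1LinTwoRunKit NE7K1LinWalkLine
  NE7K1LinWalkLineEntries NE7K1LinWalkLineBlocks NE7K1LinSchurBilinError NE7K1LinSchurKernelDecay

variable {d : ℕ} {n L : ℕ} [NeZero L] {K Nf : Fin (d + 1) → ℕ} {T : Finset (Fin (d + 1) → ℤ)}

/-! ### §0 The label set is the coarse torus -/

/-- the labels of the fine torus are the coarse representatives. [folklore] -/
theorem labels_eq (hNf : Nf = fun i => L * K i) (hT : T = boxDom (dbl Nf)) : T.image (blk L) = boxDom (dbl K) := by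
  subst hNf hT; exact image_blk_dbl (NeZero.one_le : 1 ≤ L) K

/-- a label is a coarse representative. [folklore] -/
theorem label_mem (hNf : Nf = fun i => L * K i) (hT : T = boxDom (dbl Nf)) (b : ↥(T.image (blk L))) : b.1 ∈ boxDom (dbl K) := by
  rw [← labels_eq hNf hT]; exact b.2

/-! ### §1 The fluctuation block of `H_B^𝕋`: floor, sparse entries, conjugation error, Combes–Thomas -/

section Fluct

/-- **THE FLUCTUATION FLOOR ON THE TORUS**: `(2n²∕L^{d+1})‖ψ‖² ≤ ⟨ψ, Dψ⟩` (run B's block Poincaré + domination). [folklore] -/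
theorem torFluct_coercive (hn : 1 ≤ n) (hT : T = boxDom (dbl Nf)) (hNf' : ∀ i, 1 ≤ Nf i) (hT' : IsBlockUnion (n * L) T)
    (ψ : ↥(T.image (blk L)) × NZ d L → ℝ) :
    2 * (n : ℝ) ^ 2 / (L : ℝ) ^ (d + 1) * (ψ ⬝ᵥ ψ) ≤ ψ ⬝ᵥ (torB (isBlockUnion_fine hT') n 0 Nf).toBlocks₂₂ *ᵥ ψ := by
  rw [← form_inr]
  exact (runB_form_ge_fluct hn hT' le_rfl 0 ψ).trans (torB_form_ge hT' hT hNf' 0 _)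

/-- sparse entries of `D`: `|D(p,q)| ≤ 8(d+1)(nL)²∕L^{d+1}`, and `D(p,q) ≠ 0` with different sites forces TORUS-ADJACENT sites. [folklore] -/
theorem torFluct_entry (hK : ∀ i, 1 ≤ K i) (hNf : Nf = fun i => L * K i) (hT : T = boxDom (dbl Nf)) (hT' : IsBlockUnion (n * L) T)
    (p q : ↥(T.image (blk L)) × NZ d L) :
    |(torB (isBlockUnion_fine hT') n 0 Nf).toBlocks₂₂ p q| ≤ 8 * ((d : ℝ) + 1) * ((n : ℝ) * L) ^ 2 / (L : ℝ) ^ (d + 1) ∧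
      ((torB (isBlockUnion_fine hT') n 0 Nf).toBlocks₂₂ p q ≠ 0 → p.1 ≠ q.1 → tadj K p.1.1 q.1.1 ≠ 0) := by
  have hNf' : ∀ i, 1 ≤ Nf i := by subst hNf; exact mul_pos_side (NeZero.one_le : 1 ≤ L) hK
  refine ⟨abs_torB_inr_le hNf' hT _ (Sum.inr p) q, fun h hne => ?_⟩
  rcases torB_zero_ne_zero_adj hK hNf hT (isBlockUnion_fine hT') (c := Sum.inr p) (c' := Sum.inr q) h with he | ht
  · exact absurd he hne
  · exact ht

/-- **THE CONJUGATION ERROR OF THE CENTRED WEIGHT** `φ = θ·|site · − c₀|_∞` on `D`: `|Σ_{p,q}(e^{φ_p − φ_q} − 1)D_{pq}w_pw_q| ≤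
(e^θ − 1)·16(d+1)²n²L²·‖w‖²` (only torus-adjacent pairs contribute, the weight is 1-Lipschitz along torus bonds). [folklore] -/
theorem torFluct_conjError_le (hK : ∀ i, 1 ≤ K i) (hNf : Nf = fun i => L * K i) (hT : T = boxDom (dbl Nf))
    (hT' : IsBlockUnion (n * L) T) {θ : ℝ} (hθ : 0 ≤ θ) (w : ↥(T.image (blk L)) × NZ d L → ℝ) :
    |∑ p, ∑ q, (Real.exp (θ * supNorm (p.1.1 - fun i => (K i : ℤ)) - θ * supNorm (q.1.1 - fun i => (K i : ℤ))) - 1) *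
        (torB (isBlockUnion_fine hT') n 0 Nf).toBlocks₂₂ p q * (w p * w q)| ≤
      (Real.exp θ - 1) * (16 * ((d : ℝ) + 1) ^ 2 * (n : ℝ) ^ 2 * (L : ℝ) ^ 2) * (w ⬝ᵥ w) := by
  classical
  have hTc : T.image (blk L) = boxDom (dbl K) := labels_eq hNf hT
  set D := (torB (isBlockUnion_fine hT') n 0 Nf).toBlocks₂₂ with hD
  set E : Matrix (↥(T.image (blk L)) × NZ d L) (↥(T.image (blk L)) × NZ d L) ℝ := Matrix.of fun p q =>
    (Real.exp (θ * supNorm (p.1.1 - fun i => (K i : ℤ)) - θ * supNorm (q.1.1 - fun i => (K i : ℤ))) - 1) * D p q with hE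
  have hL0 : (0 : ℝ) < L := by exact_mod_cast (NeZero.one_le : 1 ≤ L)
  -- the double sum is `⟨w, Ew⟩`
  have hsum : ∑ p, ∑ q, (Real.exp (θ * supNorm (p.1.1 - fun i => (K i : ℤ)) - θ * supNorm (q.1.1 - fun i => (K i : ℤ))) - 1) *
      D p q * (w p * w q) = w ⬝ᵥ E *ᵥ w := by
    simp only [dotProduct, mulVec, hE, Matrix.of_apply, Finset.mul_sum]
    exact Finset.sum_congr rfl fun p _ => Finset.sum_congr rfl fun q _ => by ring
  set θD : ℝ := 8 * ((d : ℝ) + 1) * ((n : ℝ) * L) ^ 2 / (L : ℝ) ^ (d + 1) with hθD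
  have hθD0 : 0 ≤ θD := by rw [hθD]; positivity
  have hEentry : ∀ p q, |E p q| ≤ (Real.exp θ - 1) * θD := by
    intro p q
    simp only [hE, Matrix.of_apply, abs_mul]
    by_cases hpq : p.1 = q.1
    · rw [hpq, sub_self, Real.exp_zero, sub_self, abs_zero, zero_mul]
      exact mul_nonneg (by linarith [Real.add_one_le_exp θ]) hθD0
    · by_cases hz : D p q = 0
      · rw [hz, abs_zero, mul_zero]; exact mul_nonneg (by linarith [Real.add_one_le_exp θ]) hθD0
      · have hadj : tadj K p.1.1 q.1.1 ≠ 0 := (torFluct_entry hK hNf hT hT' p q).2 hz hpq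
        refine mul_le_mul ?_ ((torFluct_entry hK hNf hT hT' p q).1) (abs_nonneg _) (by linarith [Real.add_one_le_exp θ])
        refine abs_exp_sub_one_le ?_
        have h1 := abs_supNorm_sub_ctr_sub_le hK (label_mem hNf hT p.1) (label_mem hNf hT q.1) hadj
        rw [← mul_sub, abs_mul, abs_of_nonneg hθ]
        nlinarith [h1]
  have hErel : ∀ p q, E p q ≠ 0 → tadj K p.1.1 q.1.1 ≠ 0 := by
    intro p q h
    simp only [hE, Matrix.of_apply] at h
    have hz : D p q ≠ 0 := right_ne_zero_of_mul h
    have hpq : p.1 ≠ q.1 := by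
      intro hpq
      apply h
      rw [hpq, sub_self, Real.exp_zero, sub_self, zero_mul]
    exact (torFluct_entry hK hNf hT hT' p q).2 hz hpq
  -- the sparse bound, then Cauchy–Schwarz
  have hsp := mulVec_sq_le_of_sparse E (fun p q : ↥(T.image (blk L)) × NZ d L => tadj K p.1.1 q.1.1 ≠ 0) hEentry hErel
    (by positivity)
    (fun p => card_filter_fst_le (fun b' : ↥(T.image (blk L)) => tadj K p.1.1 b'.1 ≠ 0) (card_filter_tadj_le hK hTc p.1).1)
    (fun q => card_filter_fst_le (fun b' : ↥(T.image (blk L)) => tadj K b'.1 q.1.1 ≠ 0) (card_filter_tadj_le hK hTc q.1).2) w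
  have hww : 0 ≤ w ⬝ᵥ w := Finset.sum_nonneg fun i _ => mul_self_nonneg _
  have hcs : (w ⬝ᵥ E *ᵥ w) ^ 2 ≤ (w ⬝ᵥ w) * (E *ᵥ w ⬝ᵥ E *ᵥ w) := by
    have := Finset.sum_mul_sq_le_sq_mul_sq (Finset.univ) w (E *ᵥ w)
    simp only [dotProduct, ← sq] at this ⊢
    exact this
  set C : ℝ := (Real.exp θ - 1) * θD * (2 * ((d : ℝ) + 1) * (L : ℝ) ^ (d + 1)) with hC
  have hC0 : 0 ≤ C := by rw [hC]; exact mul_nonneg (mul_nonneg (by linarith [Real.add_one_le_exp θ]) hθD0) (by positivity)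
  have hsq : (w ⬝ᵥ E *ᵥ w) ^ 2 ≤ (C * (w ⬝ᵥ w)) ^ 2 := by
    refine hcs.trans ?_
    have h3 : E *ᵥ w ⬝ᵥ E *ᵥ w ≤ C ^ 2 * (w ⬝ᵥ w) := hsp.trans (le_of_eq (by rw [hC]; ring))
    nlinarith [h3, hww]
  have habs : |w ⬝ᵥ E *ᵥ w| ≤ C * (w ⬝ᵥ w) :=
    abs_le.2 ⟨(abs_le_of_sq_le_sq' hsq (mul_nonneg hC0 hww)).1, (abs_le_of_sq_le_sq' hsq (mul_nonneg hC0 hww)).2⟩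
  rw [hsum]
  refine habs.trans (le_of_eq ?_)
  rw [hC, hθD]
  field_simp
  ring

/-- **COMBES–THOMAS FOR THE TORUS FLUCTUATION BLOCK**: if `16(d+1)²L^{d+3}(e^θ − 1) ≤ 1` (`θ ≥ 0`; file 28's condition, FREE of the
mesh and of the torus size) then `|D⁻¹(p,q)| ≤ (L^{d+1}∕n²)·e^{−θ(|site p − c₀|_∞ − |site q − c₀|_∞)}`. [folklore] -/
theorem torFluct_inv_entry_decay (hn : 1 ≤ n) (hK : ∀ i, 1 ≤ K i) (hNf : Nf = fun i => L * K i) (hT : T = boxDom (dbl Nf))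
    (hT' : IsBlockUnion (n * L) T) {θ : ℝ} (hθ : 0 ≤ θ)
    (hθs : 16 * ((d : ℝ) + 1) ^ 2 * (L : ℝ) ^ (d + 3) * (Real.exp θ - 1) ≤ 1) (p q : ↥(T.image (blk L)) × NZ d L) :
    |((torB (isBlockUnion_fine hT') n 0 Nf).toBlocks₂₂)⁻¹ p q| ≤
      (L : ℝ) ^ (d + 1) / (n : ℝ) ^ 2 *
        Real.exp (-(θ * supNorm (p.1.1 - fun i => (K i : ℤ)) - θ * supNorm (q.1.1 - fun i => (K i : ℤ)))) := by
  have hNf' : ∀ i, 1 ≤ Nf i := by subst hNf; exact mul_pos_side (NeZero.one_le : 1 ≤ L) hK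
  set D := (torB (isBlockUnion_fine hT') n 0 Nf).toBlocks₂₂ with hD
  have hL0 : (0 : ℝ) < L := by exact_mod_cast (NeZero.one_le : 1 ≤ L)
  have hn0 : (0 : ℝ) < n := by exact_mod_cast hn
  have hσ : 0 < 2 * (n : ℝ) ^ 2 / (L : ℝ) ^ (d + 1) := by positivity
  have hpos : ∀ ω, 2 * (n : ℝ) ^ 2 / (L : ℝ) ^ (d + 1) * (ω ⬝ᵥ ω) ≤ ω ⬝ᵥ D.mulVec ω := torFluct_coercive hn hT hNf' hT'
  have herr : ∀ w, -(2 * (n : ℝ) ^ 2 / (L : ℝ) ^ (d + 1) / 2) * (w ⬝ᵥ w) ≤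
      ∑ j, ∑ k, (Real.exp (θ * supNorm (j.1.1 - fun i => (K i : ℤ)) - θ * supNorm (k.1.1 - fun i => (K i : ℤ))) - 1) *
        D j k * (w j * w k) := by
    intro w
    have h := torFluct_conjError_le hK hNf hT hT' hθ w
    have hww : 0 ≤ w ⬝ᵥ w := Finset.sum_nonneg fun i _ => mul_self_nonneg _
    have hsmall : (Real.exp θ - 1) * (16 * ((d : ℝ) + 1) ^ 2 * (n : ℝ) ^ 2 * (L : ℝ) ^ 2) ≤
        2 * (n : ℝ) ^ 2 / (L : ℝ) ^ (d + 1) / 2 := by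
      rw [div_div, le_div_iff₀ (by positivity)]
      have e : (Real.exp θ - 1) * (16 * ((d : ℝ) + 1) ^ 2 * (n : ℝ) ^ 2 * (L : ℝ) ^ 2) * ((L : ℝ) ^ (d + 1) * 2) =
          (16 * ((d : ℝ) + 1) ^ 2 * (L : ℝ) ^ (d + 3) * (Real.exp θ - 1)) * (2 * (n : ℝ) ^ 2) := by ring
      rw [e]
      nlinarith [hθs, sq_nonneg (n : ℝ)]
    have := (abs_le.1 h).1
    nlinarith [this, hsmall, hww]
  have hDunit : IsUnit D.det := isUnit_det_of_coercive D hσ hpos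
  have hv : D.mulVec (fun i => D⁻¹ i q) = Pi.single q 1 := by
    funext j
    have : (D.mulVec fun i => D⁻¹ i q) j = (D * D⁻¹) j q := by simp [mulVec, dotProduct, Matrix.mul_apply]
    rw [this, mul_nonsing_inv D hDunit, Matrix.one_apply, Pi.single_apply]
  have h := combesThomas_form D _ (fun j : ↥(T.image (blk L)) × NZ d L => θ * supNorm (j.1.1 - fun i => (K i : ℤ)))
    hσ hpos herr q _ hv p
  refine h.trans (le_of_eq ?_)
  congr 1
  field_simp

end Fluct

end Summit.QuantumFields.BalabanUV.T4Continuum.NE7K1LinTorusFluctDecay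

end
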